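import Summits.ABC.ABC.Theorems.CongruentialReceptacleTameLocalReceptacleCellLawsDefs
import Mathlib.Analysis.PSeries
import Mathlib.Analysis.SpecialFunctions.Pow.Real
import Mathlib.Algebra.Order.Ring.Pow
import Mathlib.Algebra.Field.GeomSum

/-!
# Crux `CongruentialReceptacle.TameLocalReceptacle` (stmt-ABC-14354), line `grh-friable-cell-resolution`:
# the tilt bound (registered stub `stub_tiltBound`)

Registered stub `stub_tiltBound : TiltBound` of the checked skeleton
`Cruxes/TameLocalReceptacle/Lines/grh_friable_cell_resolution.lean` (lead `prover-line-stmt-ABC-14354-a1-0`),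
over the local model of `…TameLocalReceptacleCellLawsDefs.lean` (`dens`, `normD`, `cellModel`, `TiltBound`) and the
key-cell vocabulary of `…TameLocalReceptacleKeyCellDefs.lean` (`Pos`, `keyWeight`, `oddPrimesBelow`).

STATEMENT.  Two local models with exponents `a, a' ∈ [3/4, 1]³` that agree at the compared position `P` satisfy
`Σ_{q odd prime < Q} Σ_{1 ≤ v ≤ V} keyWeight · (q−1)² · |cellModel a P q v − cellModel a' P q v| ≤ C_T`
with an absolute constant `C_T` (here `C_T = 1536 · Σ_n n^{−5/4}`).

PROOF (elementary real analysis, all `q` in the sum are odd primes, so `q ≥ 3`).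
* `g = q^{−a} ≤ s := q^{−3/4} ≤ 1/2` (as `s⁴ = q^{−3} ≤ 1/27 ≤ 1/16`), so `0 ≤ g/(1−g) ≤ 2s` and the normalising
  factors satisfy `c ≤ D, D' ≤ c + 6s` with `c = (q−2)/(q−1) ≥ 1/2`; hence `|1/D − 1/D'| ≤ 4|D − D'| ≤ 24 s`
  (`TiltBook.abs_one_div_sub_le`).
* The numerators coincide (pick hypothesis), so `(q−1)² |cellModel a − cellModel a'| = q^{−v a_P} |1/D − 1/D'|`
  (`TiltBook.sq_mul_abs_cellModel_sub`), and `q^{−v a_P} ≤ s^v`.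
* `keyWeight (P.exps v) q = (v+1) log q`, `(v+1) s^v ≤ 4 s (3/4)^v` (Bernoulli `v+1 ≤ 2 (3/2)^v` and `s ≤ 1/2`),
  `log q ≤ 4 q^{1/4}`; so the `(q, v)` term is `≤ 96 · log q · q^{−3/2} (3/4)^v ≤ 384 · q^{−5/4} (3/4)^v`
  (`TiltBook.tilt_term_le`).
* `Σ_{v ≤ V} (3/4)^v ≤ 4` and `Σ_{q < Q} q^{−5/4} ≤ Σ_n n^{−5/4} < ∞` (`Real.summable_nat_rpow`).

Helpers live in the sub-namespace `TiltBook`.  Deliberately NOT here: anything about the other stubs of the line.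
-/

-- `Summit.<Summit>.<Problem>` is the mandated summit-side namespace (CONVENTIONS §2); for the
-- single-conjunct summit `ABC` the two coincide, so the duplicate `ABC.ABC` is deliberate.
set_option linter.dupNamespace false

noncomputable section

namespace Summit.ABC.ABC.Theorems.TameLocalReceptacle

open Finset

namespace TiltBook

/-! ### Membership in `oddPrimesBelow` -/

/-- Members of `oddPrimesBelow Q` are odd primes, hence at least `3`. [folklore] -/
theorem three_le_of_mem_oddPrimesBelow {Q q : ℕ} (h : q ∈ oddPrimesBelow Q) : 3 ≤ q := by
  unfold oddPrimesBelow at h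
  rw [Finset.mem_filter] at h
  have h2 := h.2.1.two_le
  have hne := h.2.2
  omega

/-- `oddPrimesBelow Q ⊆ range Q`. [folklore] -/
theorem oddPrimesBelow_subset (Q : ℕ) : oddPrimesBelow Q ⊆ range Q := by
  unfold oddPrimesBelow
  exact Finset.filter_subset _ _

/-! ### The window weight of a pure key -/

/-- `keyWeight (P.exps v) q = (v + 1) · log q` for every position `P`. [folklore] -/
theorem keyWeight_exps (P : Pos) (v q : ℕ) : keyWeight (P.exps v) q = ((v : ℝ) + 1) * Real.log q := by
  cases P <;> simp [keyWeight, Pos.exps]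

/-- The picked exponent lies in `[3/4, 1]` if all three exponents do. [folklore] -/
theorem pick_mem_Icc (P : Pos) {aA aB aC : ℝ} (haA : aA ∈ Set.Icc (3 / 4 : ℝ) 1)
    (haB : aB ∈ Set.Icc (3 / 4 : ℝ) 1) (haC : aC ∈ Set.Icc (3 / 4 : ℝ) 1) :
    P.pick aA aB aC ∈ Set.Icc (3 / 4 : ℝ) 1 := by
  cases P
  exacts [haA, haB, haC]

/-! ### Numerics of `s = q^{-3/4}` -/

/-- For real `x ≥ 3`: `x^{−3/4} ≤ 1/2` (fourth powers: `x^{−3} ≤ 1/27 ≤ 1/16`). [folklore] -/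
theorem rpow_neg_le_half {x : ℝ} (hx : 3 ≤ x) : x ^ (-(3 / 4 : ℝ)) ≤ 1 / 2 := by
  have hx0 : 0 ≤ x := by linarith
  refine le_of_pow_le_pow_left₀ (by norm_num : (4 : ℕ) ≠ 0) (by norm_num : (0 : ℝ) ≤ 1 / 2) ?_
  have h4 : (x ^ (-(3 / 4 : ℝ))) ^ 4 = (x ^ 3)⁻¹ := by
    rw [← Real.rpow_mul_natCast hx0]
    have : (-(3 / 4 : ℝ)) * ((4 : ℕ) : ℝ) = -((3 : ℕ) : ℝ) := by norm_num
    rw [this, Real.rpow_neg hx0, Real.rpow_natCast]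
  rw [h4]
  have hx3 : (3 : ℝ) ^ 3 ≤ x ^ 3 := pow_le_pow_left₀ (by norm_num) hx 3
  calc (x ^ 3)⁻¹ ≤ ((3 : ℝ) ^ 3)⁻¹ := inv_anti₀ (by norm_num) hx3
    _ ≤ (1 / 2 : ℝ) ^ 4 := by norm_num

/-- `0 ≤ dens a q`. [folklore] -/
theorem dens_nonneg (a : ℝ) (q : ℕ) : 0 ≤ dens a q :=
  Real.rpow_nonneg (Nat.cast_nonneg q) _

/-- For `q ≥ 1` and `a ≥ 3/4`: `dens a q = q^{−a} ≤ q^{−3/4}`. [folklore] -/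
theorem dens_le {a : ℝ} {q : ℕ} (hq : 1 ≤ (q : ℝ)) (ha : 3 / 4 ≤ a) :
    dens a q ≤ (q : ℝ) ^ (-(3 / 4 : ℝ)) := by
  unfold dens
  exact Real.rpow_le_rpow_of_exponent_le hq (by linarith)

/-- For `0 ≤ g ≤ s ≤ 1/2`: `0 ≤ g/(1 − g) ≤ 2 s`. [folklore] -/
theorem div_one_sub_bounds {g s : ℝ} (hg : 0 ≤ g) (hgs : g ≤ s) (hs : s ≤ 1 / 2) :
    0 ≤ g / (1 - g) ∧ g / (1 - g) ≤ 2 * s := by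
  have h1 : 0 < 1 - g := by linarith
  refine ⟨div_nonneg hg h1.le, ?_⟩
  rw [div_le_iff₀ h1]
  nlinarith [mul_nonneg (le_trans hg hgs) (by linarith : (0 : ℝ) ≤ 1 - 2 * g)]

/-- For `q ≥ 1`, `a ≥ 3/4` and `v : ℕ`: `q^{−v a} ≤ (q^{−3/4})^v`. [folklore] -/
theorem rpow_neg_mul_le {x a : ℝ} (hx : 1 ≤ x) (ha : 3 / 4 ≤ a) (v : ℕ) :
    x ^ (-((v : ℝ) * a)) ≤ (x ^ (-(3 / 4 : ℝ))) ^ v := by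
  rw [← Real.rpow_mul_natCast (by linarith : (0 : ℝ) ≤ x)]
  refine Real.rpow_le_rpow_of_exponent_le hx ?_
  have hv : (0 : ℝ) ≤ v := Nat.cast_nonneg v
  nlinarith [mul_nonneg hv (sub_nonneg.2 ha)]

/-- For `0 ≤ s ≤ 1/2` and `v ≥ 1`: `(v + 1) s^v ≤ 4 s (3/4)^v` (Bernoulli: `w + 2 ≤ 2 (3/2)^w`). [folklore] -/
theorem succ_mul_pow_le {s : ℝ} (hs0 : 0 ≤ s) (hs : s ≤ 1 / 2) {v : ℕ} (hv : 1 ≤ v) :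
    ((v : ℝ) + 1) * s ^ v ≤ 4 * s * (3 / 4 : ℝ) ^ v := by
  obtain ⟨w, rfl⟩ : ∃ w, v = w + 1 := ⟨v - 1, by omega⟩
  have hb : 1 + (w : ℝ) * (1 / 2) ≤ (1 + 1 / 2 : ℝ) ^ w := one_add_mul_le_pow (by norm_num) w
  have hsw : s ^ w ≤ (1 / 2 : ℝ) ^ w := pow_le_pow_left₀ hs0 hs w
  have h34 : (0 : ℝ) ≤ (3 / 4) ^ w := pow_nonneg (by norm_num) w
  have hmul : (1 + 1 / 2 : ℝ) ^ w * (1 / 2) ^ w = (3 / 4) ^ w := by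
    rw [← mul_pow]; norm_num
  have h2 : (w : ℝ) + 2 ≤ 2 * (1 + 1 / 2 : ℝ) ^ w := by linarith
  push_cast
  calc ((w : ℝ) + 1 + 1) * s ^ (w + 1) = ((w : ℝ) + 2) * s ^ w * s := by ring
    _ ≤ 2 * (1 + 1 / 2 : ℝ) ^ w * (1 / 2) ^ w * s :=
        mul_le_mul_of_nonneg_right (mul_le_mul h2 hsw (pow_nonneg hs0 w) (by positivity)) hs0
    _ = 2 * s * ((1 + 1 / 2 : ℝ) ^ w * (1 / 2) ^ w) := by ring
    _ = 2 * s * (3 / 4 : ℝ) ^ w := by rw [hmul]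
    _ ≤ 4 * s * (3 / 4 : ℝ) ^ (w + 1) := by
        rw [pow_succ]
        nlinarith [mul_nonneg hs0 h34]

/-- `Σ_{v ∈ Icc 1 V} (3/4)^v ≤ 4`. [folklore] -/
theorem sum_Icc_geom_le (V : ℕ) : ∑ v ∈ Icc 1 V, (3 / 4 : ℝ) ^ v ≤ 4 := by
  calc ∑ v ∈ Icc 1 V, (3 / 4 : ℝ) ^ v ≤ ∑ v ∈ range (V + 1), (3 / 4 : ℝ) ^ v := by
        refine Finset.sum_le_sum_of_subset_of_nonneg (fun v hv => ?_)
          (fun v _ _ => pow_nonneg (by norm_num) v)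
        rw [Finset.mem_Icc] at hv
        rw [Finset.mem_range]
        omega
    _ ≤ 4 := by
        rw [geom_sum_eq (by norm_num : (3 / 4 : ℝ) ≠ 1)]
        have h0 : (0 : ℝ) ≤ (3 / 4) ^ (V + 1) := pow_nonneg (by norm_num) _
        rw [div_le_iff_of_neg (by norm_num : (3 / 4 : ℝ) - 1 < 0)]
        linarith

/-! ### The normalising factors -/

/-- For `q ≥ 3`: `1/2 ≤ (q−2)/(q−1)`. [folklore] -/
theorem half_le_ratio {q : ℕ} (hq : 3 ≤ q) : (1 / 2 : ℝ) ≤ ((q : ℝ) - 2) / ((q : ℝ) - 1) := by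
  have hq3 : (3 : ℝ) ≤ q := by exact_mod_cast hq
  rw [le_div_iff₀ (by linarith)]
  linarith

/-- For `q ≥ 3` and exponents in `[3/4, 1]`: `c ≤ normD ≤ c + 6 q^{−3/4}` with `c = (q−2)/(q−1)`. [folklore] -/
theorem normD_bounds {aA aB aC : ℝ} {q : ℕ} (hq : 3 ≤ q) (haA : aA ∈ Set.Icc (3 / 4 : ℝ) 1)
    (haB : aB ∈ Set.Icc (3 / 4 : ℝ) 1) (haC : aC ∈ Set.Icc (3 / 4 : ℝ) 1) :
    ((q : ℝ) - 2) / ((q : ℝ) - 1) ≤ normD aA aB aC q ∧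
      normD aA aB aC q ≤ ((q : ℝ) - 2) / ((q : ℝ) - 1) + 6 * (q : ℝ) ^ (-(3 / 4 : ℝ)) := by
  have hq3 : (3 : ℝ) ≤ q := by exact_mod_cast hq
  have hq1 : (1 : ℝ) ≤ q := by linarith
  have hs := rpow_neg_le_half hq3
  obtain ⟨hA0, hA⟩ := div_one_sub_bounds (dens_nonneg aA q) (dens_le hq1 haA.1) hs
  obtain ⟨hB0, hB⟩ := div_one_sub_bounds (dens_nonneg aB q) (dens_le hq1 haB.1) hs
  obtain ⟨hC0, hC⟩ := div_one_sub_bounds (dens_nonneg aC q) (dens_le hq1 haC.1) hs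
  unfold normD
  constructor <;> linarith

/-- If `1/2 ≤ c ≤ D, D' ≤ c + 6 s` then `|1/D − 1/D'| ≤ 24 s`. [folklore] -/
theorem abs_one_div_sub_le {c D D' s : ℝ} (hc : 1 / 2 ≤ c) (hD : c ≤ D) (hD6 : D ≤ c + 6 * s)
    (hD' : c ≤ D') (hD6' : D' ≤ c + 6 * s) : |1 / D - 1 / D'| ≤ 24 * s := by
  have hDpos : 0 < D := by linarith
  have hD'pos : 0 < D' := by linarith
  rw [div_sub_div _ _ hDpos.ne' hD'pos.ne', one_mul, mul_one, abs_div,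
    abs_of_pos (mul_pos hDpos hD'pos), div_le_iff₀ (mul_pos hDpos hD'pos)]
  have h6 : |D' - D| ≤ 6 * s := abs_sub_le_iff.2 ⟨by linarith, by linarith⟩
  have hs0 : 0 ≤ s := by linarith
  have hDD : 1 / 4 ≤ D * D' := by
    nlinarith [mul_nonneg (by linarith : (0 : ℝ) ≤ D - 1 / 2) (by linarith : (0 : ℝ) ≤ D' - 1 / 2)]
  nlinarith [mul_nonneg hs0 (by linarith : (0 : ℝ) ≤ 4 * (D * D') - 1)]

/-! ### The cell term -/

/-- With equal exponent at the compared position, `(q−1)² · |cellModel a − cellModel a'| = q^{−v a_P} · |1/D − 1/D'|`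
(`q ≥ 3`, so `(q−1)² ≠ 0` cancels). [folklore] -/
theorem sq_mul_abs_cellModel_sub {aA aB aC aA' aB' aC' : ℝ} {P : Pos} {q : ℕ} (hq : 3 ≤ q)
    (hpick : P.pick aA aB aC = P.pick aA' aB' aC') (v : ℕ) :
    (((q : ℝ) - 1) ^ 2) * |cellModel aA aB aC P q v - cellModel aA' aB' aC' P q v| =
      (q : ℝ) ^ (-((v : ℝ) * P.pick aA aB aC)) *
        |1 / normD aA aB aC q - 1 / normD aA' aB' aC' q| := by
  have hq3 : (3 : ℝ) ≤ q := by exact_mod_cast hq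
  have hc1 : (q : ℝ) - 1 ≠ 0 := (by linarith : (0 : ℝ) < (q : ℝ) - 1).ne'
  have hc : ((q : ℝ) - 1) ^ 2 ≠ 0 := pow_ne_zero 2 hc1
  have hx : 0 ≤ (q : ℝ) ^ (-((v : ℝ) * P.pick aA aB aC)) := Real.rpow_nonneg (Nat.cast_nonneg q) _
  have hsplit : ∀ x c D D' : ℝ, x / (c * D) - x / (c * D') = x / c * (1 / D - 1 / D') := by
    intro x c D D'
    rw [div_mul_eq_div_div, div_mul_eq_div_div]
    ring
  have key : cellModel aA aB aC P q v - cellModel aA' aB' aC' P q v =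
      (q : ℝ) ^ (-((v : ℝ) * P.pick aA aB aC)) / (((q : ℝ) - 1) ^ 2) *
        (1 / normD aA aB aC q - 1 / normD aA' aB' aC' q) := by
    unfold cellModel
    rw [← hpick]
    exact hsplit _ _ _ _
  rw [key, abs_mul, abs_of_nonneg (div_nonneg hx (sq_nonneg _)), ← mul_assoc, mul_div_cancel₀ _ hc]

/-- **The `(q, v)` term** (odd prime `q`, i.e. `q ≥ 3`, and `v ≥ 1`): it is at most `384 · q^{−5/4} · (3/4)^v`.
[folklore] -/
theorem tilt_term_le {aA aB aC aA' aB' aC' : ℝ} {P : Pos}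
    (haA : aA ∈ Set.Icc (3 / 4 : ℝ) 1) (haB : aB ∈ Set.Icc (3 / 4 : ℝ) 1) (haC : aC ∈ Set.Icc (3 / 4 : ℝ) 1)
    (haA' : aA' ∈ Set.Icc (3 / 4 : ℝ) 1) (haB' : aB' ∈ Set.Icc (3 / 4 : ℝ) 1)
    (haC' : aC' ∈ Set.Icc (3 / 4 : ℝ) 1) (hpick : P.pick aA aB aC = P.pick aA' aB' aC') {q v : ℕ}
    (hq : 3 ≤ q) (hv : 1 ≤ v) :
    keyWeight (P.exps v) q *
        ((((q : ℝ) - 1) ^ 2) * |cellModel aA aB aC P q v - cellModel aA' aB' aC' P q v|) ≤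
      384 * (q : ℝ) ^ (-(5 / 4 : ℝ)) * (3 / 4 : ℝ) ^ v := by
  have hq3 : (3 : ℝ) ≤ q := by exact_mod_cast hq
  have hq1 : (1 : ℝ) ≤ q := by linarith
  have hq0 : (0 : ℝ) < q := by linarith
  rw [keyWeight_exps, sq_mul_abs_cellModel_sub hq hpick]
  set s : ℝ := (q : ℝ) ^ (-(3 / 4 : ℝ)) with hs_def
  set x : ℝ := (q : ℝ) ^ (-((v : ℝ) * P.pick aA aB aC)) with hx_def
  set A : ℝ := |1 / normD aA aB aC q - 1 / normD aA' aB' aC' q| with hA_def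
  have hs0 : 0 ≤ s := Real.rpow_nonneg hq0.le _
  have hs2 : s ≤ 1 / 2 := rpow_neg_le_half hq3
  have hx0 : 0 ≤ x := Real.rpow_nonneg hq0.le _
  have hxs : x ≤ s ^ v := rpow_neg_mul_le hq1 (pick_mem_Icc P haA haB haC).1 v
  have hA0 : 0 ≤ A := abs_nonneg _
  have hA : A ≤ 24 * s := by
    obtain ⟨hD, hD6⟩ := normD_bounds hq haA haB haC
    obtain ⟨hD', hD6'⟩ := normD_bounds hq haA' haB' haC'
    exact abs_one_div_sub_le (half_le_ratio hq) hD hD6 hD' hD6'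
  have hlog0 : 0 ≤ Real.log q := Real.log_natCast_nonneg q
  have hlog : Real.log q ≤ 4 * (q : ℝ) ^ (1 / 4 : ℝ) := by
    calc Real.log q ≤ (q : ℝ) ^ (1 / 4 : ℝ) / (1 / 4) := Real.log_le_rpow_div hq0.le (by norm_num)
      _ = 4 * (q : ℝ) ^ (1 / 4 : ℝ) := by ring
  have hpow : (q : ℝ) ^ (1 / 4 : ℝ) * (s * s) = (q : ℝ) ^ (-(5 / 4 : ℝ)) := by
    rw [hs_def, ← Real.rpow_add hq0, ← Real.rpow_add hq0]
    rw [show (1 / 4 : ℝ) + (-(3 / 4) + -(3 / 4)) = -(5 / 4) by norm_num]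
  have hgeom : ((v : ℝ) + 1) * s ^ v ≤ 4 * s * (3 / 4 : ℝ) ^ v := succ_mul_pow_le hs0 hs2 hv
  have h34 : (0 : ℝ) ≤ (3 / 4) ^ v := pow_nonneg (by norm_num) v
  calc ((v : ℝ) + 1) * Real.log q * (x * A)
      = Real.log q * ((((v : ℝ) + 1) * x) * A) := by ring
    _ ≤ Real.log q * ((((v : ℝ) + 1) * s ^ v) * (24 * s)) := by
        refine mul_le_mul_of_nonneg_left ?_ hlog0
        refine mul_le_mul (mul_le_mul_of_nonneg_left hxs (by positivity)) hA hA0 ?_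
        exact mul_nonneg (by positivity) (pow_nonneg hs0 v)
    _ ≤ Real.log q * ((4 * s * (3 / 4 : ℝ) ^ v) * (24 * s)) := by
        refine mul_le_mul_of_nonneg_left ?_ hlog0
        exact mul_le_mul_of_nonneg_right hgeom (by linarith)
    _ = 96 * Real.log q * ((s * s) * (3 / 4 : ℝ) ^ v) := by ring
    _ ≤ 96 * (4 * (q : ℝ) ^ (1 / 4 : ℝ)) * ((s * s) * (3 / 4 : ℝ) ^ v) := by
        have : 0 ≤ (s * s) * (3 / 4 : ℝ) ^ v := mul_nonneg (mul_nonneg hs0 hs0) h34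
        nlinarith
    _ = 384 * ((q : ℝ) ^ (1 / 4 : ℝ) * (s * s)) * (3 / 4 : ℝ) ^ v := by ring
    _ = 384 * (q : ℝ) ^ (-(5 / 4 : ℝ)) * (3 / 4 : ℝ) ^ v := by rw [hpow]

end TiltBook

open TiltBook in
/-- **Registered stub `stub_tiltBound`** (line `grh-friable-cell-resolution` of crux stmt-ABC-14354): the TILT BOUND —
two local models with exponents in `[3/4, 1]` agreeing at the compared position differ, in total `keyWeight`-weighted
model cell mass `Σ_{q odd prime < Q} Σ_{1 ≤ v ≤ V} keyWeight · (q−1)² · |cellModel a − cellModel a'|`, by at most the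
absolute constant `C_T = 1536 · Σ_n n^{−5/4}`, uniformly in `Q, V` (termwise bound `384 · q^{−5/4} (3/4)^v`,
`Σ_v (3/4)^v ≤ 4`, and `Σ_{q < Q} q^{−5/4} ≤ Σ_n n^{−5/4}`). [folklore] -/
theorem stub_tiltBound : TiltBound := by
  refine ⟨1536 * (∑' n : ℕ, (n : ℝ) ^ (-(5 / 4 : ℝ))), ?_⟩
  intro aA aB aC aA' aB' aC' P haA haB haC haA' haB' haC' hpick Q V
  have hsum : Summable (fun n : ℕ => (n : ℝ) ^ (-(5 / 4 : ℝ))) :=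
    Real.summable_nat_rpow.2 (by norm_num)
  have hnn : ∀ n : ℕ, 0 ≤ (n : ℝ) ^ (-(5 / 4 : ℝ)) := fun n => Real.rpow_nonneg (Nat.cast_nonneg n) _
  calc ∑ q ∈ oddPrimesBelow Q, ∑ v ∈ Icc 1 V, keyWeight (P.exps v) q *
          ((((q : ℝ) - 1) ^ 2) * |cellModel aA aB aC P q v - cellModel aA' aB' aC' P q v|)
      ≤ ∑ q ∈ oddPrimesBelow Q, ∑ v ∈ Icc 1 V, 384 * (q : ℝ) ^ (-(5 / 4 : ℝ)) * (3 / 4 : ℝ) ^ v := by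
        refine Finset.sum_le_sum fun q hq => Finset.sum_le_sum fun v hv => ?_
        exact tilt_term_le haA haB haC haA' haB' haC' hpick (three_le_of_mem_oddPrimesBelow hq)
          (Finset.mem_Icc.1 hv).1
    _ ≤ ∑ q ∈ oddPrimesBelow Q, 1536 * (q : ℝ) ^ (-(5 / 4 : ℝ)) := by
        refine Finset.sum_le_sum fun q _ => ?_
        rw [← Finset.mul_sum]
        have h4 := mul_le_mul_of_nonneg_left (sum_Icc_geom_le V)
          (mul_nonneg (by norm_num : (0 : ℝ) ≤ 384) (hnn q))
        linarith
    _ ≤ ∑ q ∈ range Q, 1536 * (q : ℝ) ^ (-(5 / 4 : ℝ)) :=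
        Finset.sum_le_sum_of_subset_of_nonneg (oddPrimesBelow_subset Q) fun q _ _ =>
          mul_nonneg (by norm_num) (hnn q)
    _ = 1536 * ∑ q ∈ range Q, (q : ℝ) ^ (-(5 / 4 : ℝ)) := by rw [Finset.mul_sum]
    _ ≤ 1536 * (∑' n : ℕ, (n : ℝ) ^ (-(5 / 4 : ℝ))) := by
        have := hsum.sum_le_tsum (range Q) (fun n _ => hnn n)
        linarith

end Summit.ABC.ABC.Theorems.TameLocalReceptacle

end
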